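import Summits.CriticalPhenomena.PercolationContinuityZ3.Theses.PercNearOneGluing
import Summits.CriticalPhenomena.PercolationContinuityZ3.Theorems.PercNearOneGluingNoHeavyLowerTailSuffices

/-!
# `NoHeavyLowerTailGlue` (route PercNearOneGluing, item stmt-CriticalPhenomena-14716)

The glue-by-name item `NoHeavyLowerTailGlue : NoHeavyLowerTail → NearOneGluing` of the route
thesis.  It is definitionally the already proved support item `NoHeavyLowerTailSuffices`
(stmt-CriticalPhenomena-4577, `noHeavyLowerTailSuffices_proof`): both unfold to the same
implication between the engine crux (no heavy lower tail of `N = |C(o) ∩ A|` given a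
`(1-δ)`-reliable relay set `A`) and Kozma–Nitzan near-one gluing.  The mathematical content
(choice `δ = min (δ₀/2) (ε/3)`, pairwise reliability of `A` by the union bound through `b`, the
cover `{o ↮ b} ⊆ {N = 0} ∪ {1 ≤ N < t} ∪ ({t ≤ N} ∩ {o ↮ b})` and the Harris + Markov bound on
the last piece) lives in `PercNearOneGluingNoHeavyLowerTailSuffices.lean`; here we only re-point it.
-/

namespace Summit.CriticalPhenomena.PercolationContinuityZ3.Theorems

open Summit.CriticalPhenomena.PercolationContinuityZ3.Theses.PercNearOneGluing

/-- **`NoHeavyLowerTailGlue`** (item stmt-CriticalPhenomena-14716 of route PercNearOneGluing):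
the engine crux `NoHeavyLowerTail` implies `NearOneGluing`.  Definitionally equal to
`NoHeavyLowerTailSuffices`, so the proof is `noHeavyLowerTailSuffices_proof` read at this type. -/
theorem noHeavyLowerTailGlue_proof : NoHeavyLowerTailGlue := by
  unfold NoHeavyLowerTailGlue
  intro h
  exact noHeavyLowerTailSuffices_proof h

end Summit.CriticalPhenomena.PercolationContinuityZ3.Theorems
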